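import Mathlib
import Summits.Schanuel.Schanuel.Theorems.RigidCoreMinimalCounterexampleInAclLogSector
import Summits.Schanuel.Schanuel.Theorems.AclSubsetLogFreeCore.Negative.ExpAclField

/-!
# `GL₂(ℤ)`-TRANSPORT OF RANK-2 FIRST FAILURES — crux stmt-Schanuel-0969 `RigidCore.MinimalCounterexampleInAcl`

Line `kernel-arithmetic-selection`, stub `stub_glTwoReduction` (gen 13 `GL₂(ℤ)` transport),
`--supports stmt-Schanuel-0969`.

For a rank-2 tuple `x = (x₀, x₁)` and an integer matrix `B = [[a, b], [−v, u]]` of determinant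
`a u + b v = 1` put `x̃ = B x = (a x₀ + b x₁, −v x₀ + u x₁)`; the inverse matrix is the INTEGER
matrix `[[u, −b], [v, a]]`, i.e. `x₀ = u x̃₀ − b x̃₁`, `x₁ = v x̃₀ + a x̃₁`.  Consequently

* `x̃` is ℚ-linearly independent iff `x` is;
* the fields `ℚ(x̃, e^{x̃})` and `ℚ(x, eˣ)` COINCIDE (as intermediate fields of `ℂ/ℚ`): the
  `x̃ᵢ` are integer combinations of the `xⱼ`, and `e^{x̃ᵢ}` are integer LAURENT monomials in the
  `e^{xⱼ}` (`e^{m p + n q} = (e^p)^m (e^q)^n`, `m n : ℤ`; intermediate fields are closed under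
  `zpow`), and conversely — so the transcendence degrees agree;
* if both `e^{x̃ᵢ}` are algebraic then so are both `e^{xⱼ}` (same Laurent monomials inside the
  intermediate field `ℚ̄ ∩ ℂ = algebraicClosure ℚ ℂ`), i.e. the log / off-log split is preserved;
* `x̃ ∈ acl(∅)² ⟹ x ∈ acl(∅)²`, since `acl^{ℂ_exp}(∅)` is a subring of `ℂ` containing `ℤ`
  (`add_mem_expAcl`, `mul_mem_expAcl`, `intCast_mem_expAcl`).

Hence `B` transports rank-2 first failures (`firstFailures 2`: ℚ-linearly independent,
`trdeg ℚ(x, eˣ) < 2`, Schanuel below rank 2) to rank-2 first failures, off-log ones to off-log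
ones, and pulls `acl`-membership back.  In the line this reduces the mixed sector of (S*)₂
(`e^{M·x} ∈ ℚ̄` for some `M ∈ ℤ² ∖ 0`) to the case `e^{x₀} ∈ ℚ̄` (primitive direction + Bézout).

## References

* [Lang1966] S. Lang, *Introduction to transcendental numbers*, Addison–Wesley 1966, Ch. II §1
  (invariance of `trdeg ℚ(x, eˣ)` under `GLₙ(ℤ)` acting on `x`; folklore bookkeeping around
  Schanuel's conjecture).
-/

noncomputable section

set_option linter.dupNamespace false

open Complex Set

namespace Summit.Schanuel.Schanuel.Cruxes.MinimalCounterexampleInAcl.KernelArithmeticSelection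

open Literature.NumberTheory.Transcendental (SchanuelRank)
open Summit.Schanuel.Schanuel.Theorems.AclSubsetLogFreeCore.Negative

/-! ## Integer combinations and their exponentials inside an intermediate field -/

/-- An integer combination of two elements of an intermediate field lies in it. [folklore] -/
theorem intCombo_mem (K : IntermediateField ℚ ℂ) {p q : ℂ} (hp : p ∈ K) (hq : q ∈ K)
    (m n : ℤ) : (m : ℂ) * p + (n : ℂ) * q ∈ K :=
  add_mem (mul_mem (intCast_mem K m) hp) (mul_mem (intCast_mem K n) hq)

/-- `e^{m p + n q} = (e^p)^m · (e^q)^n` for integers `m, n` (Laurent monomial). [folklore] -/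
theorem cexp_intCombo (p q : ℂ) (m n : ℤ) :
    cexp ((m : ℂ) * p + (n : ℂ) * q) = cexp p ^ m * cexp q ^ n := by
  rw [Complex.exp_add, Complex.exp_int_mul, Complex.exp_int_mul]

/-- If `e^p, e^q` lie in an intermediate field then so does `e^{m p + n q}` for integers `m, n`
(intermediate fields are closed under integer powers). [folklore] -/
theorem cexp_intCombo_mem (K : IntermediateField ℚ ℂ) {p q : ℂ} (hp : cexp p ∈ K)
    (hq : cexp q ∈ K) (m n : ℤ) : cexp ((m : ℂ) * p + (n : ℂ) * q) ∈ K := by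
  rw [cexp_intCombo]
  exact mul_mem (zpow_mem hp m) (zpow_mem hq n)

/-- If `e^p, e^q` are algebraic then so is `e^{m p + n q}` for integers `m, n`. [folklore] -/
theorem isAlgebraic_cexp_intCombo {p q : ℂ} (hp : IsAlgebraic ℚ (cexp p))
    (hq : IsAlgebraic ℚ (cexp q)) (m n : ℤ) :
    IsAlgebraic ℚ (cexp ((m : ℂ) * p + (n : ℂ) * q)) := by
  rw [← mem_algebraicClosure_iff] at hp hq ⊢
  exact cexp_intCombo_mem _ hp hq m n

/-- If `y₀, y₁` are integer combinations of `x₀, x₁` then `ℚ(y, eʸ) ≤ ℚ(x, eˣ)`. [folklore] -/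
theorem adjoin_le_of_intCombo {x y : Fin 2 → ℂ} (m n m' n' : ℤ)
    (h0 : y 0 = (m : ℂ) * x 0 + (n : ℂ) * x 1) (h1 : y 1 = (m' : ℂ) * x 0 + (n' : ℂ) * x 1) :
    IntermediateField.adjoin ℚ (range y ∪ range (cexp ∘ y)) ≤
      IntermediateField.adjoin ℚ (range x ∪ range (cexp ∘ x)) := by
  set K := IntermediateField.adjoin ℚ (range x ∪ range (cexp ∘ x)) with hK
  have hx : ∀ i, x i ∈ K := fun i => IntermediateField.subset_adjoin _ _ (Or.inl ⟨i, rfl⟩)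
  have hex : ∀ i, cexp (x i) ∈ K := fun i => IntermediateField.subset_adjoin _ _ (Or.inr ⟨i, rfl⟩)
  have hy : ∀ i, y i ∈ K ∧ cexp (y i) ∈ K := by
    rw [Fin.forall_fin_two, h0, h1]
    exact ⟨⟨intCombo_mem K (hx 0) (hx 1) m n, cexp_intCombo_mem K (hex 0) (hex 1) m n⟩,
      ⟨intCombo_mem K (hx 0) (hx 1) m' n', cexp_intCombo_mem K (hex 0) (hex 1) m' n'⟩⟩
  rw [IntermediateField.adjoin_le_iff]
  rintro _ (⟨i, rfl⟩ | ⟨i, rfl⟩)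
  · exact (hy i).1
  · exact (hy i).2

/-- Transport of a transcendence-degree bound along an EQUALITY of intermediate fields (the
`ℚ`-algebra structure on `↥K` depends on `K`, so this is `subst`, not `rw`). [folklore] -/
theorem trdeg_lt_of_eq {K L : IntermediateField ℚ ℂ} (h : K = L) {c : Cardinal}
    (hL : Algebra.trdeg ℚ ↥L < c) : Algebra.trdeg ℚ ↥K < c := by
  subst h
  exact hL

/-! ## The transport along `B = [[a, b], [−v, u]]`, `a u + b v = 1` -/

/-- **`SL₂(ℤ)`-transport of rank-2 first failures** (general form: `y = B x`). [folklore] -/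
theorem glTwo_transport {x y : Fin 2 → ℂ} {a b u v : ℤ} (hbez : a * u + b * v = 1)
    (hy0 : y 0 = (a : ℂ) * x 0 + (b : ℂ) * x 1) (hy1 : y 1 = -(v : ℂ) * x 0 + (u : ℂ) * x 1)
    (hx : x ∈ firstFailures 2) :
    y ∈ firstFailures 2 ∧
      ((∃ i, Transcendental ℚ (cexp (x i))) → ∃ i, Transcendental ℚ (cexp (y i))) ∧
      ((∀ i, y i ∈ expAcl) → ∀ i, x i ∈ expAcl) := by
  have hbezC : (a : ℂ) * u + b * v = 1 := by exact_mod_cast hbez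
  have hy1' : y 1 = ((-v : ℤ) : ℂ) * x 0 + (u : ℂ) * x 1 := by rw [hy1, Int.cast_neg]
  -- the inverse formulas
  have hx0 : x 0 = (u : ℂ) * y 0 + ((-b : ℤ) : ℂ) * y 1 := by
    rw [hy0, hy1, Int.cast_neg]
    linear_combination (-(x 0)) * hbezC
  have hx1 : x 1 = (v : ℂ) * y 0 + (a : ℂ) * y 1 := by
    rw [hy0, hy1]
    linear_combination (-(x 1)) * hbezC
  -- (1) linear independence
  have hli : LinearIndependent ℚ x := hx.1
  have hliy : LinearIndependent ℚ y := by
    rw [Fintype.linearIndependent_iff] at hli ⊢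
    intro g hg
    rw [Fin.sum_univ_two, hy0, hy1] at hg
    have key := hli ![g 0 * a - g 1 * v, g 0 * b + g 1 * u] (by
      rw [Fin.sum_univ_two]
      simp only [Matrix.cons_val_zero, Matrix.cons_val_one, Matrix.cons_val_fin_one,
        Rat.smul_def] at hg ⊢
      push_cast
      linear_combination hg)
    have h0 := key 0
    have h1 := key 1
    simp only [Matrix.cons_val_zero, Matrix.cons_val_one, Matrix.cons_val_fin_one] at h0 h1
    have hbezQ : (a : ℚ) * u + b * v = 1 := by exact_mod_cast hbez
    refine Fin.forall_fin_two.2 ⟨?_, ?_⟩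
    · linear_combination (u : ℚ) * h0 + (v : ℚ) * h1 - g 0 * hbezQ
    · linear_combination (-b : ℚ) * h0 + (a : ℚ) * h1 - g 1 * hbezQ
  -- (2) the fields coincide
  have hK : IntermediateField.adjoin ℚ (range y ∪ range (cexp ∘ y)) =
      IntermediateField.adjoin ℚ (range x ∪ range (cexp ∘ x)) :=
    le_antisymm (adjoin_le_of_intCombo a b (-v) u hy0 hy1')
      (adjoin_le_of_intCombo u (-b) v a hx0 hx1)
  refine ⟨⟨hliy, ?_, hx.2.2⟩, ?_, ?_⟩
  · exact trdeg_lt_of_eq hK hx.2.1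
  · -- (3) off-log is preserved (contrapositive: both `e^{yᵢ}` algebraic ⟹ both `e^{xⱼ}` algebraic)
    rintro ⟨i, hi⟩
    by_contra h
    simp only [not_exists, Transcendental, not_not] at h
    have halgx : ∀ i, IsAlgebraic ℚ (cexp (x i)) := by
      refine Fin.forall_fin_two.2 ⟨?_, ?_⟩
      · rw [hx0]
        exact isAlgebraic_cexp_intCombo (h 0) (h 1) u (-b)
      · rw [hx1]
        exact isAlgebraic_cexp_intCombo (h 0) (h 1) v a
    exact hi (halgx i)
  · -- (4) `acl`-membership pulls back
    intro hacl
    refine Fin.forall_fin_two.2 ⟨?_, ?_⟩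
    · rw [hx0]
      exact add_mem_expAcl (mul_mem_expAcl (intCast_mem_expAcl u) (hacl 0))
        (mul_mem_expAcl (intCast_mem_expAcl (-b)) (hacl 1))
    · rw [hx1]
      exact add_mem_expAcl (mul_mem_expAcl (intCast_mem_expAcl v) (hacl 0))
        (mul_mem_expAcl (intCast_mem_expAcl a) (hacl 1))

/-- **Stub `stub_glTwoReduction` (registered, PROVED): `GL₂(ℤ)` acts on rank-2 first failures
preserving the log/off-log split and `acl`-membership.**  For `x ∈ firstFailures 2` and integers
with `a u + b v = 1`, the tuple `x̃ = (a x₀ + b x₁, −v x₀ + u x₁)` is again a rank-2 first failure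
(ℚ-linear independence is preserved by the invertible integer matrix; `ℚ(x̃, e^{x̃}) = ℚ(x, eˣ)`
since the `e^{x̃ᵢ}` are integer Laurent monomials in the `e^{xⱼ}` and conversely, so the
transcendence degrees agree), it is off-log if `x` is (if both `e^{x̃ᵢ} ∈ ℚ̄` then
`e^{x₀} = (e^{x̃₀})^u (e^{x̃₁})^{−b}`, `e^{x₁} = (e^{x̃₀})^v (e^{x̃₁})^{a}` are algebraic), and
`x̃ ∈ acl(∅)² ⟹ x ∈ acl(∅)²` (`x₀ = u x̃₀ − b x̃₁`, `x₁ = v x̃₀ + a x̃₁`; `acl(∅)` is a subring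
containing `ℤ`). [folklore] -/
theorem stub_glTwoReduction : ∀ (x : Fin 2 → ℂ) (a b u v : ℤ), a * u + b * v = 1 → x ∈ Summit.Schanuel.Schanuel.Cruxes.MinimalCounterexampleInAcl.KernelArithmeticSelection.firstFailures 2 → (![(a : ℂ) * x 0 + (b : ℂ) * x 1, -(v : ℂ) * x 0 + (u : ℂ) * x 1] : Fin 2 → ℂ) ∈ Summit.Schanuel.Schanuel.Cruxes.MinimalCounterexampleInAcl.KernelArithmeticSelection.firstFailures 2 ∧ ((∃ i, Transcendental ℚ (Complex.exp (x i))) → ∃ i, Transcendental ℚ (Complex.exp ((![(a : ℂ) * x 0 + (b : ℂ) * x 1, -(v : ℂ) * x 0 + (u : ℂ) * x 1] : Fin 2 → ℂ) i))) ∧ ((∀ i, (![(a : ℂ) * x 0 + (b : ℂ) * x 1, -(v : ℂ) * x 0 + (u : ℂ) * x 1] : Fin 2 → ℂ) i ∈ Summit.Schanuel.Schanuel.Theorems.AclSubsetLogFreeCore.Negative.expAcl) → ∀ i, x i ∈ Summit.Schanuel.Schanuel.Theorems.AclSubsetLogFreeCore.Negative.expAcl) := by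
  intro x a b u v hbez hx
  exact glTwo_transport hbez rfl rfl hx

end Summit.Schanuel.Schanuel.Cruxes.MinimalCounterexampleInAcl.KernelArithmeticSelection

end
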